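import Literature.Computability.QuantumComplexity.GenericStabilizerRank
import Literature.Computability.QuantumComplexity.StabilizerSimulationMagicT
import HarnessLib

/-!
# The generic stabilizer rank: `χ_n = O(2^{n/2})` (Lovitz–Steffan 2022, Prop. 5.2) — discharged

Proof of the named fact `LovitzSteffan2022_prop52` of
`Literature.Computability.QuantumComplexity.GenericStabilizerRank` (kept in a sibling file so
that the statement file keeps its light imports; the companion file
`GenericStabilizerRankProofs` discharges `χ_n ≥ n + 1` and Proposition 5.3):

B. Lovitz, V. Steffan, *New techniques for bounding stabilizer rank*, Quantum 6 (2022) 692 =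
arXiv:2110.07781, §5, Proposition 5.2: "`χ_n = O(2^{n/2})`." We prove
`χ_n ≤ 8^{⌊n/6⌋} · 2^{n mod 6} ≤ 8 · 2^{n/2}` for EVERY `n` (so the fact holds with `C = 8`,
`n₀ = 0`).

## The printed proof and the road taken here

Printed proof (p. 13 of the held text): "This follows directly from our Fact 5.1 [all but finitely
many `[ψ] ∈ P¹` maximize `χ([ψ^{⊗n}])` — irreducibility of the Veronese curve `ν_n(P¹)` against the
finite union of linear spaces `Σ_r(Stab_n)`] and [Qassim–Pashayan–Gosset 2021, Thm. 2], which
states that equatorial states (an infinite family of states) have stabilizer rank `O(2^{n/2})`."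
QPG21's Theorem 2 is proved by contracting a chain of six-qubit cat states
`|cat_6(R_θ)⟩ ∝ Σ_{|x| even} e^{iθ|x|}|x⟩` — each of stabilizer rank `≤ 4`, because the
EVEN-weight part of the symmetric subspace of six qubits lies in the span of the four stabilizer
states `|0^6⟩, |1^6⟩, |E_6⟩ = Σ_{|x| even}|x⟩, |K_6⟩ = ∏_{i<j} CZ_{ij}|E_6⟩ (= S^{⊗6}|E_6⟩)`
(QPG21, the display before Thm. 2) — into `|cat_{24t+6}(R_θ)⟩` and projecting one qubit onto
`|R_θ⟩`; the contraction steps rest on the closure of stabilizer states under stabilizer-basis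
post-selection (the stabilizer formalism), and Fact 5.1 on the finiteness of `Stab_n` — neither
of which the tree has for its operational `stabilizerStates` (the Clifford-monoid orbit of
`|0ⁿ⟩`, `StabilizerRank.lean`).

We therefore prove the same bound by the block route of Bravyi–Smith–Smolin 2016, §I
("`χ_n ≤ (χ_6)^{n/6}`", here for COVERS of the symmetric subspace rather than decompositions of
one state), fed with a six-qubit cover of size exactly `8 = 2^{6/2}` that completes QPG21's
four-state span of the even sector by four stabilizer states spanning the odd sector:

* **`S^6(ℂ²)` lies in the span of 8 stabilizer states** (`CliffordSim.LS52.identity`,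
  `exists_dickeCover_six`): with `D_k = Σ_{|x|=k} e_x` the weight indicators (the basis of
  `S^n(ℂ²)` named in the proof of Prop. 5.4), `|O_6⟩ = Σ_{|x| odd}|x⟩` and
  `q(x) = x₀x₁ + x₀x₂ + x₁x₂`,
  `D_0, D_2, D_4, D_6 ∈ span{|0^6⟩, |1^6⟩, |E_6⟩, S^{⊗6}|E_6⟩}` (QPG21's `cat_6` decomposition) and
  `D_1, D_3, D_5 ∈ span{|O_6⟩, S^{⊗6}|O_6⟩, |σ⟩, S^{⊗6}|σ⟩}`, `|σ⟩ = Σ_{|x| odd} (−1)^{q(x)}|x⟩`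
  (indeed `|σ⟩ − i·S^{⊗6}|σ⟩ ∝ D_1 − D_5`, while the symmetric stabilizer states only reach
  `D_1 + D_5` and `D_3` in the odd sector). The eight states are prepared from `|0^6⟩` by explicit
  words over `H, S, CNOT`, and the seven identities `8·D_k = Σ_{i<8} c_{ki} · (word_i)|0^6⟩`,
  `c_{ki} ∈ ℤ[i]`, are **decided by the kernel** with the executable simulator of
  `CliffordSimulator.lean` (exactly as `χ(|T⟩^{⊗6}) ≤ 7` is checked there);
* **covers multiply over blocks** (`symCover_mul`): if `r` stabilizer states span a space
  containing every symmetric (= weight-dependent) function on `a` qubits and `s` states do so on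
  `b` qubits, the `r s` tensor products do so on `a + b` qubits, because a symmetric `f` on
  `a + b` qubits is `Σ_{j ≤ b} f_j ⊗ D_j` with `f_j(x) = f(|x| + j)` symmetric
  (`|z| = |z₁| + |z₂|`, `hw_split`) and tensor products of stabilizer states are stabilizer
  states (`tensorVec_mem_stabilizerStates`, Bravyi–Smith–Smolin 2016, §I);
* the `2^r` basis states cover everything on `r < 6` leftover qubits (`symCover_basis`), so
  `S^n(ℂ²)` is covered by `8^{⌊n/6⌋} 2^{n mod 6} = 2^{n/2 + (n mod 6)/2}` stabilizer states
  (`symCover_blocks`); every `ψ^{⊗n}` is symmetric (`tensorPow_eq_of_hw`: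
  `ψ^{⊗n}(x) = ψ₁^{|x|} ψ₀^{n−|x|}`), hence `χ(ψ^{⊗n}) ≤ 8^{⌊n/6⌋} 2^{n mod 6}`
  (`stabilizerRank_tensorPow_le_blocks`) and so is the supremum `χ_n`
  (`genericStabilizerRank_le_blocks`), which is `≤ 8 · 2^{n/2}`
  (`LovitzSteffan2022_prop52_holds`).

Optimality remark (not used, not formalized): in the odd sector of six qubits the wire-symmetric
stabilizer states span only `D_1 + D_5` and `D_3` (Dehaene–De Moor normal form), so no
7-element stabilizer family spans `S^6(ℂ²)`; the block route through `S^6` gives exactly the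
printed exponent `1/2` and no better.

## References

* B. Lovitz, V. Steffan, *New techniques for bounding stabilizer rank*, Quantum 6 (2022) 692,
  arXiv:2110.07781: §5, Proposition 5.2 (p. 13 of the held text) and its proof; proof of
  Proposition 5.4 (the basis `Σ_{|x|=k} e_x` of `S^n(ℂ²)`).
* H. Qassim, H. Pashayan, D. Gosset, *Improved upper bounds on the stabilizer rank of magic
  states*, Quantum 5 (2021) 606, arXiv:2106.07740: Theorem 2 (`χ(R_θ^{⊗m}) = O(2^{m/2})`),
  the stabilizer decomposition of `|cat_6(R_θ)⟩` displayed before it, Lemma 1 / Theorem 3.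
* S. Bravyi, G. Smith, J. A. Smolin, *Trading classical and quantum computational resources*,
  Phys. Rev. X 6 (2016) 021043: §I (`χ_{n+m} ≤ χ_n χ_m`, `χ_n ≤ (χ_6)^{n/6}`), §IV (the states
  `|E_6⟩`, `|O_6⟩`).
-/

noncomputable section

namespace Literature.Computability.QuantumComplexity

open _root_.Computability Cryptography Matrix

/-! ### Hamming weight -/

namespace SymCover

/-- The Hamming weight `|x|` of a basis label. [folklore] -/
def hw {n : ℕ} (x : QReg n) : ℕ := (Finset.univ.filter fun i => x i = true).card

/-- `|x|` as a sum of indicator bits. [folklore] -/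
theorem hw_eq_sum {n : ℕ} (x : QReg n) : hw x = ∑ i, if x i = true then 1 else 0 :=
  Finset.card_filter _ _

/-- `|x| ≤ n`. [folklore] -/
theorem hw_le {n : ℕ} (x : QReg n) : hw x ≤ n :=
  (Finset.card_filter_le _ _).trans (by simp)

/-- The weight of a label on `a + b` wires is the sum of the weights of its two blocks.
[folklore] -/
theorem hw_split {a b : ℕ} (z : QReg (a + b)) :
    hw z = hw (fun i => z (Fin.castAdd b i)) + hw (fun j => z (Fin.natAdd a j)) := by
  simp only [hw_eq_sum]
  exact Fin.sum_univ_add _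

/-- The weight of a label on `n + 1` wires: the first `n` bits plus the last bit. [folklore] -/
theorem hw_succ {n : ℕ} (x : QReg (n + 1)) :
    hw x = hw (Fin.init x) + (if x (Fin.last n) = true then 1 else 0) := by
  simp only [hw_eq_sum]
  exact Fin.sum_univ_castSucc _

/-- The empty label has weight `0`. [folklore] -/
theorem hw_zero (x : QReg 0) : hw x = 0 := by
  simp [hw]

/-- **Amplitudes of a tensor power depend only on the Hamming weight**:
`ψ^{⊗n}(x) = ψ(1)^{|x|} ψ(0)^{n-|x|}` (one factor at a time, `CliffordSim.tensorPow_succ_apply`).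
[cite: LovitzSteffan2022, §5 (proof of Fact 5.1, the Veronese embedding)] -/
theorem tensorPow_apply_hw (ψ : QReg 1 → ℂ) : ∀ (n : ℕ) (x : QReg n),
    tensorPow ψ n x = ψ (fun _ => true) ^ hw x * ψ (fun _ => false) ^ (n - hw x)
  | 0, x => by
    rw [hw_zero]
    simp [tensorPow]
  | n + 1, x => by
    rw [CliffordSim.tensorPow_succ_apply, tensorPow_apply_hw ψ n (Fin.init x), hw_succ]
    have hle : hw (Fin.init x) ≤ n := hw_le _
    cases h : x (Fin.last n)
    · simp only [Bool.false_eq_true, if_false, add_zero]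
      rw [Nat.succ_sub hle, pow_succ]
      ring
    · simp only [if_true]
      rw [Nat.add_sub_add_right, pow_succ]
      ring

/-- **Tensor powers are symmetric**: `ψ^{⊗n}` is a function of the Hamming weight (the point
`[ψ^{⊗n}]` of the Veronese curve lies in `S^n(ℂ²)`).
[cite: LovitzSteffan2022, §5 (proof of Fact 5.1, the Veronese embedding)] -/
theorem tensorPow_eq_of_hw (ψ : QReg 1 → ℂ) (n : ℕ) :
    ∃ g : ℕ → ℂ, tensorPow ψ n = fun x => g (hw x) :=
  ⟨fun w => ψ (fun _ => true) ^ w * ψ (fun _ => false) ^ (n - w), funext (tensorPow_apply_hw ψ n)⟩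

/-! ### Symmetric stabilizer covers: products over blocks, and the trivial cover -/

/-- **Symmetric stabilizer covers multiply over blocks** (the cover form of
Bravyi–Smith–Smolin's `χ_{n+m} ≤ χ_n χ_m`): if `≤ r` stabilizer states span a space containing
every weight-dependent function on `a` qubits and `≤ s` states do so on `b` qubits, then the
`≤ r s` tensor products (stabilizer states again) do so on `a + b` qubits — a symmetric `f` on
`a + b` qubits is `Σ_{j ≤ b} f_j ⊗ D_j` with `f_j(x) = f(|x| + j)` and `D_j` the weight-`j`
indicator. [cite: BravyiSmithSmolin2016, §I] -/
theorem symCover_mul {a b r s : ℕ}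
    (hA : ∃ (ι : Type) (_ : Fintype ι) (σ : ι → QReg a → ℂ), Fintype.card ι ≤ r ∧
      (∀ i, σ i ∈ stabilizerStates a) ∧
      ∀ g : ℕ → ℂ, (fun x => g (hw x)) ∈ Submodule.span ℂ (Set.range σ))
    (hB : ∃ (κ : Type) (_ : Fintype κ) (τ : κ → QReg b → ℂ), Fintype.card κ ≤ s ∧
      (∀ j, τ j ∈ stabilizerStates b) ∧
      ∀ g : ℕ → ℂ, (fun y => g (hw y)) ∈ Submodule.span ℂ (Set.range τ)) :
    ∃ (ι : Type) (_ : Fintype ι) (ρ : ι → QReg (a + b) → ℂ), Fintype.card ι ≤ r * s ∧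
      (∀ i, ρ i ∈ stabilizerStates (a + b)) ∧
      ∀ g : ℕ → ℂ, (fun z => g (hw z)) ∈ Submodule.span ℂ (Set.range ρ) := by
  obtain ⟨ι, _, σ, hι, hσ, hA⟩ := hA
  obtain ⟨κ, _, τ, hκ, hτ, hB⟩ := hB
  refine ⟨ι × κ, inferInstance, fun p => tensorVec (σ p.1) (τ p.2), ?_, ?_, ?_⟩
  · rw [Fintype.card_prod]
    exact Nat.mul_le_mul hι hκ
  · exact fun p => tensorVec_mem_stabilizerStates (hσ p.1) (hτ p.2)
  · intro g
    have hspan : ∀ (u : QReg a → ℂ) (v : QReg b → ℂ), u ∈ Submodule.span ℂ (Set.range σ) →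
        v ∈ Submodule.span ℂ (Set.range τ) →
        tensorVec u v ∈ Submodule.span ℂ (Set.range fun p : ι × κ => tensorVec (σ p.1) (τ p.2)) := by
      intro u v hu hv
      obtain ⟨c, rfl⟩ := (Submodule.mem_span_range_iff_exists_fun ℂ).1 hu
      obtain ⟨d, rfl⟩ := (Submodule.mem_span_range_iff_exists_fun ℂ).1 hv
      rw [tensorVec_fintype_sum_smul]
      exact Submodule.sum_mem _ fun i _ => Submodule.sum_mem _ fun j _ =>
        Submodule.smul_mem _ _ (Submodule.subset_span ⟨(i, j), rfl⟩)
    have hdec : (fun z : QReg (a + b) => g (hw z)) =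
        ∑ j ∈ Finset.range (b + 1), tensorVec (fun x : QReg a => g (hw x + j))
          (fun y : QReg b => if hw y = j then (1 : ℂ) else 0) := by
      funext z
      rw [Finset.sum_apply, hw_split z]
      simp only [tensorVec_apply, mul_ite, mul_one, mul_zero]
      rw [Finset.sum_ite_eq, if_pos (Finset.mem_range.2 (Nat.lt_succ_of_le (hw_le _)))]
    rw [hdec]
    exact Submodule.sum_mem _ fun j _ =>
      hspan _ _ (hA fun w => g (w + j)) (hB fun w => if w = j then 1 else 0)

/-- **The trivial cover**: the `2ⁿ` computational basis states (stabilizer states) span every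
function on `n` qubits, in particular every symmetric one.
[cite: BravyiSmithSmolin2016, §I ("`χ(ψ) ≤ 2ⁿ`")] -/
theorem symCover_basis (n : ℕ) :
    ∃ (ι : Type) (_ : Fintype ι) (σ : ι → QReg n → ℂ), Fintype.card ι ≤ 2 ^ n ∧
      (∀ i, σ i ∈ stabilizerStates n) ∧
      ∀ g : ℕ → ℂ, (fun x => g (hw x)) ∈ Submodule.span ℂ (Set.range σ) := by
  refine ⟨QReg n, inferInstance, basisState, ?_, basisState_mem_stabilizerStates, fun g => ?_⟩
  · simp [QReg]
  · rw [eq_sum_smul_basisState (fun x : QReg n => g (hw x))]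
    exact Submodule.sum_mem _ fun z _ => Submodule.smul_mem _ _ (Submodule.subset_span ⟨z, rfl⟩)

end SymCover

/-! ### The six-qubit cover, decided by the kernel -/

namespace CliffordSim

open LightCone SymCover

namespace Vec

/-- The tree of the weight-`k` indicator `D_k = Σ_{|x| = k} e_x` on `n` qubits (the basis of
`S^n(ℂ²)` named in the proof of Lovitz–Steffan's Prop. 5.4). [folklore] -/
def dicke : (n : ℕ) → ℕ → Vec n
  | 0, k => leaf (if k = 0 then 1 else 0)
  | n + 1, k => node (dicke n k) (match k with
      | 0 => zero n
      | k + 1 => dicke n k)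

/-- Amplitudes of `dicke n k`: `1` on labels of weight `k`, `0` elsewhere. [folklore] -/
theorem eval_dicke : ∀ (n k : ℕ) (x : Fin n → Bool),
    (dicke n k).eval x = if hw x = k then 1 else 0
  | 0, k, x => by
    rw [hw_zero]
    show (if k = 0 then (1 : Amp) else 0) = if 0 = k then 1 else 0
    by_cases hk : k = 0
    · rw [if_pos hk, if_pos hk.symm]
    · rw [if_neg hk, if_neg (Ne.symm hk)]
  | n + 1, 0, x => by
    rw [hw_succ]
    show (node (dicke n 0) (zero n)).eval x = _
    rw [eval_node]
    cases h : x (Fin.last n)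
    · simpa using eval_dicke n 0 (Fin.init x)
    · simp [eval_zero]
  | n + 1, k + 1, x => by
    rw [hw_succ]
    show (node (dicke n (k + 1)) (dicke n k)).eval x = _
    rw [eval_node]
    cases h : x (Fin.last n)
    · simpa using eval_dicke n (k + 1) (Fin.init x)
    · simp [eval_dicke n k (Fin.init x)]

/-- The complex vector of `dicke n k` is the weight-`k` indicator `D_k`. [folklore] -/
theorem toState_dicke (n k : ℕ) :
    (dicke n k).toState = fun x => if hw x = k then (1 : ℂ) else 0 := by
  funext x
  rw [toState_apply, eval_dicke]
  split_ifs <;> simp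

end Vec

/-! ### The eight words and the seven identities -/

namespace LS52

/-- The layer `S^{⊗6}` (phases `i^{|x|}`). [folklore] -/
def sLayer : List (Op 6) := [Op.S 0, Op.S 1, Op.S 2, Op.S 3, Op.S 4, Op.S 5]

/-- Preparation of `2i|σ⟩ = 2i Σ_{|x| odd} (−1)^{x₀x₁+x₀x₂+x₁x₂}|x⟩` (scaled): `X₅`, Hadamards on
wires `0–4`, the parity of wires `0,1,2` into wire `5`, one `S` there (phase `i^{1 ⊕ x₀⊕x₁⊕x₂}`),
the remaining parities, and `S₀S₁S₂` (phase `i^{x₀+x₁+x₂}`); indeed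
`i^{s} · i^{1-(s mod 2)} = i·(−1)^{⌊s/2⌋} = i·(−1)^{q(x)}` for `s = x₀+x₁+x₂`. [folklore] -/
def prepSigma : List (Op 6) :=
  BSS.xOps 5 ++ [Op.H 0, Op.H 1, Op.H 2, Op.H 3, Op.H 4, BSS.cx 0 5, BSS.cx 1 5, BSS.cx 2 5,
    Op.S 5, BSS.cx 3 5, BSS.cx 4 5, Op.S 0, Op.S 1, Op.S 2]

/-- The eight Clifford words (from `|0^6⟩`, scaled arithmetic `H ↦ √2 H`):
`|0^6⟩`, `2|1^6⟩`, `|E_6⟩`, `S^{⊗6}|E_6⟩`, `2|O_6⟩`, `2 S^{⊗6}|O_6⟩`, `2i|σ⟩`, `2i S^{⊗6}|σ⟩`.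
The span of the first four contains the even-weight symmetric functions (Qassim–Pashayan–Gosset
2021, the decomposition of `|cat_6(R_θ)⟩` displayed before Thm. 2, with `|K_6⟩ = S^{⊗6}|E_6⟩` as
vectors); the last four (an elementary completion made here) take care of the odd-weight ones.
[cite: QassimPashayanGosset2021, Thm. 2 (display before it)] -/
def ops : Fin 8 → List (Op 6) :=
  ![[],
    BSS.xOps 0 ++ [BSS.cx 0 1, BSS.cx 0 2, BSS.cx 0 3, BSS.cx 0 4, BSS.cx 0 5],
    BSS.prepE,
    BSS.prepE ++ sLayer,
    BSS.prepO,
    BSS.prepO ++ sLayer,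
    prepSigma,
    prepSigma ++ sLayer]

/-- The coefficients `c_{ki} ∈ ℤ[i] ⊆ ℤ[ω]` (coordinates of `1, ω, ω², ω³`) of the identities
`8 D_k = Σ_i c_{ki} (ops i)|0^6⟩`, `k = 0, …, 6`. [folklore] -/
def coef : Fin 7 → Fin 8 → Amp :=
  ![![⟨8, 0, 0, 0⟩, ⟨0, 0, 0, 0⟩, ⟨0, 0, 0, 0⟩, ⟨0, 0, 0, 0⟩, ⟨0, 0, 0, 0⟩, ⟨0, 0, 0, 0⟩, ⟨0, 0, 0, 0⟩, ⟨0, 0, 0, 0⟩],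
    ![⟨0, 0, 0, 0⟩, ⟨0, 0, 0, 0⟩, ⟨0, 0, 0, 0⟩, ⟨0, 0, 0, 0⟩, ⟨1, 0, 0, 0⟩, ⟨0, 0, -1, 0⟩, ⟨0, 0, -1, 0⟩, ⟨-1, 0, 0, 0⟩],
    ![⟨0, 0, 0, 0⟩, ⟨-4, 0, 0, 0⟩, ⟨4, 0, 0, 0⟩, ⟨-4, 0, 0, 0⟩, ⟨0, 0, 0, 0⟩, ⟨0, 0, 0, 0⟩, ⟨0, 0, 0, 0⟩, ⟨0, 0, 0, 0⟩],
    ![⟨0, 0, 0, 0⟩, ⟨0, 0, 0, 0⟩, ⟨0, 0, 0, 0⟩, ⟨0, 0, 0, 0⟩, ⟨2, 0, 0, 0⟩, ⟨0, 0, 2, 0⟩, ⟨0, 0, 0, 0⟩, ⟨0, 0, 0, 0⟩],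
    ![⟨-8, 0, 0, 0⟩, ⟨0, 0, 0, 0⟩, ⟨4, 0, 0, 0⟩, ⟨4, 0, 0, 0⟩, ⟨0, 0, 0, 0⟩, ⟨0, 0, 0, 0⟩, ⟨0, 0, 0, 0⟩, ⟨0, 0, 0, 0⟩],
    ![⟨0, 0, 0, 0⟩, ⟨0, 0, 0, 0⟩, ⟨0, 0, 0, 0⟩, ⟨0, 0, 0, 0⟩, ⟨1, 0, 0, 0⟩, ⟨0, 0, -1, 0⟩, ⟨0, 0, 1, 0⟩, ⟨1, 0, 0, 0⟩],
    ![⟨0, 0, 0, 0⟩, ⟨4, 0, 0, 0⟩, ⟨0, 0, 0, 0⟩, ⟨0, 0, 0, 0⟩, ⟨0, 0, 0, 0⟩, ⟨0, 0, 0, 0⟩, ⟨0, 0, 0, 0⟩, ⟨0, 0, 0, 0⟩]]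

/-- The global factor `8`. [folklore] -/
def scaleK : Amp := ⟨8, 0, 0, 0⟩

/-- **The seven identities, decided by the kernel**: `8 · D_k = Σ_{i<8} c_{ki} · (ops i)|0^6⟩` in
`ℤ[ω]^{64}` for `k = 0, …, 6` — the weight indicators of six qubits, hence all of `S^6(ℂ²)`, lie
in the span of the eight stabilizer states. [folklore] -/
theorem identity : ∀ k : Fin 7,
    Vec.smul scaleK (Vec.dicke 6 k) = lsum 8 (coef k) (fun i => run (ops i) (Vec.vac 6)) := by
  decide +kernel

/-- The eight words are `T`-free. [folklore] -/
theorem ops_clifford (i : Fin 8) : ∀ o ∈ ops i, o.isClifford = true := by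
  fin_cases i <;> decide

/-- **Eight stabilizer states whose span contains the weight indicators `D_0, …, D_6` of six
qubits** (even sector: Qassim–Pashayan–Gosset's `cat_6` decomposition; odd sector: the
completion by `|O_6⟩, S^{⊗6}|O_6⟩, |σ⟩, S^{⊗6}|σ⟩`, checked by `identity`).
[cite: QassimPashayanGosset2021, Thm. 2 (display before it: the even sector)] -/
theorem exists_dickeCover_six :
    ∃ φ : Fin 8 → QReg 6 → ℂ, (∀ i, φ i ∈ stabilizerStates 6) ∧
      ∀ k : Fin 7, (fun x : QReg 6 => if hw x = (k : ℕ) then (1 : ℂ) else 0) ∈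
        Submodule.span ℂ (Set.range φ) := by
  choose φ hφ hS using fun i => exists_stabilizer (ops i) (ops_clifford i)
  refine ⟨φ, hφ, fun k => ?_⟩
  have key := congrArg Vec.toState (identity k)
  rw [Vec.toState_smul, Vec.toState_dicke, toState_lsum] at key
  simp only [hS, smul_smul] at key
  have h8 : Amp.eval omega scaleK = 8 := by simp [Amp.eval, scaleK]
  rw [h8] at key
  have e : (fun x : QReg 6 => if hw x = (k : ℕ) then (1 : ℂ) else 0) =
      (8 : ℂ)⁻¹ • ((8 : ℂ) • fun x : QReg 6 => if hw x = (k : ℕ) then (1 : ℂ) else 0) := by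
    rw [smul_smul, inv_mul_cancel₀ (by norm_num), one_smul]
  rw [e, key]
  exact Submodule.smul_mem _ _ (Submodule.sum_mem _ fun i _ =>
    Submodule.smul_mem _ _ (Submodule.subset_span (Set.mem_range_self i)))

end LS52

end CliffordSim

/-! ### Assembly: covers of `S^n(ℂ²)` by `8^{⌊n/6⌋} 2^{n mod 6}` stabilizer states -/

namespace SymCover

/-- **`S^6(ℂ²)` is covered by `8 = 2^{6/2}` stabilizer states**: every weight-dependent function
on six qubits is a combination of `D_0, …, D_6`, each in the span of the eight states of
`CliffordSim.LS52.exists_dickeCover_six`. [cite: QassimPashayanGosset2021, Thm. 2] -/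
theorem symCover_six :
    ∃ (ι : Type) (_ : Fintype ι) (σ : ι → QReg 6 → ℂ), Fintype.card ι ≤ 8 ∧
      (∀ i, σ i ∈ stabilizerStates 6) ∧
      ∀ g : ℕ → ℂ, (fun x => g (hw x)) ∈ Submodule.span ℂ (Set.range σ) := by
  obtain ⟨φ, hφ, hD⟩ := CliffordSim.LS52.exists_dickeCover_six
  refine ⟨Fin 8, inferInstance, φ, by simp, hφ, fun g => ?_⟩
  have hdec : (fun x : QReg 6 => g (hw x)) =
      ∑ k : Fin 7, g k • fun x : QReg 6 => if hw x = (k : ℕ) then (1 : ℂ) else 0 := by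
    funext x
    have hx : hw x < 7 := Nat.lt_succ_of_le (hw_le x)
    simp only [Finset.sum_apply, Pi.smul_apply, smul_eq_mul, mul_ite, mul_one, mul_zero]
    rw [Finset.sum_eq_single (⟨hw x, hx⟩ : Fin 7)]
    · simp
    · intro k _ hk
      rw [if_neg]
      intro e
      exact hk (Fin.ext e.symm)
    · exact fun h => absurd (Finset.mem_univ _) h
  rw [hdec]
  exact Submodule.sum_mem _ fun k _ => Submodule.smul_mem _ _ (hD k)

/-- **Covers of `S^{6q+r}(ℂ²)` by `8^q 2^r` stabilizer states**: `q` six-qubit blocks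
(`symCover_six`, `symCover_mul`) and the trivial cover of the `r` leftover qubits.
[cite: BravyiSmithSmolin2016, §I ("`χ_n ≤ (χ_6)^{n/6}`")] -/
theorem symCover_blocks (r : ℕ) : ∀ q : ℕ,
    ∃ (ι : Type) (_ : Fintype ι) (σ : ι → QReg (6 * q + r) → ℂ), Fintype.card ι ≤ 8 ^ q * 2 ^ r ∧
      (∀ i, σ i ∈ stabilizerStates (6 * q + r)) ∧
      ∀ g : ℕ → ℂ, (fun x => g (hw x)) ∈ Submodule.span ℂ (Set.range σ)
  | 0 => by
    rw [show 6 * 0 + r = r by ring, show 8 ^ 0 * 2 ^ r = 2 ^ r by ring]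
    exact symCover_basis r
  | q + 1 => by
    have e1 : 6 * (q + 1) + r = 6 * q + r + 6 := by ring
    have e2 : 8 ^ (q + 1) * 2 ^ r = 8 ^ q * 2 ^ r * 8 := by ring
    rw [e1, e2]
    exact symCover_mul (symCover_blocks r q) symCover_six

end SymCover

open SymCover in
/-- **`χ(ψ^{⊗n}) ≤ 8^{⌊n/6⌋} · 2^{n mod 6}` for every single-qubit `ψ`**: `ψ^{⊗n}` is symmetric,
hence a combination of the `8^{⌊n/6⌋} 2^{n mod 6}` stabilizer states covering `S^n(ℂ²)`.
[cite: LovitzSteffan2022, Proposition 5.2] -/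
theorem stabilizerRank_tensorPow_le_blocks (ψ : QReg 1 → ℂ) (n : ℕ) :
    stabilizerRank (tensorPow ψ n) ≤ 8 ^ (n / 6) * 2 ^ (n % 6) := by
  have h := symCover_blocks (n % 6) (n / 6)
  rw [Nat.div_add_mod] at h
  obtain ⟨ι, _, σ, hcard, hσ, hspan⟩ := h
  obtain ⟨g, hg⟩ := tensorPow_eq_of_hw ψ n
  have hmem := hspan g
  rw [← hg] at hmem
  obtain ⟨c, hc⟩ := (Submodule.mem_span_range_iff_exists_fun ℂ).1 hmem
  exact (stabilizerRank_le_card c σ hσ hc.symm).trans hcard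

/-- **`χ_n ≤ 8^{⌊n/6⌋} · 2^{n mod 6}`** (the supremum of a bounded family).
[cite: LovitzSteffan2022, Proposition 5.2] -/
theorem genericStabilizerRank_le_blocks (n : ℕ) :
    genericStabilizerRank n ≤ 8 ^ (n / 6) * 2 ^ (n % 6) :=
  csSup_le (Set.range_nonempty _) (by
    rintro _ ⟨ψ, rfl⟩
    exact stabilizerRank_tensorPow_le_blocks ψ n)

/-- **Discharge of `LovitzSteffan2022_prop52`** (Lovitz–Steffan 2022, Proposition 5.2:
"`χ_n = O(2^{n/2})`"), with the explicit constant `C = 8` and threshold `n₀ = 0`: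
`χ_n ≤ 8^{⌊n/6⌋} 2^{n mod 6} = 2^{n/2 + (n mod 6)/2} ≤ 8 · 2^{n/2}`. The printed proof combines
Fact 5.1 (genericity) with Qassim–Pashayan–Gosset's `O(2^{n/2})` bound for equatorial states;
here the same bound comes from an explicit eight-state stabilizer cover of `S^6(ℂ²)` (whose even
half is QPG21's `cat_6` decomposition) and multiplicativity of covers over six-qubit blocks, see
the module docstring. [cite: LovitzSteffan2022, Proposition 5.2] -/
theorem LovitzSteffan2022_prop52_holds : LovitzSteffan2022_prop52 := by
  refine ⟨8, 0, fun n _ => ?_⟩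
  have h1 : (genericStabilizerRank n : ℝ) ≤ ((8 ^ (n / 6) * 2 ^ (n % 6) : ℕ) : ℝ) := by
    exact_mod_cast genericStabilizerRank_le_blocks n
  refine h1.trans ?_
  have hle : ((3 * (n / 6) + n % 6 : ℕ) : ℝ) ≤ 3 + (n : ℝ) / 2 := by
    have h : (3 * (n / 6) + n % 6) * 2 ≤ 6 + n := by omega
    have h' : ((3 * (n / 6) + n % 6 : ℕ) : ℝ) * 2 ≤ 6 + n := by exact_mod_cast h
    linarith
  calc ((8 ^ (n / 6) * 2 ^ (n % 6) : ℕ) : ℝ) = (2 : ℝ) ^ ((3 * (n / 6) + n % 6 : ℕ) : ℝ) := by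
        rw [Real.rpow_natCast, pow_add, pow_mul]
        norm_num
    _ ≤ (2 : ℝ) ^ (3 + (n : ℝ) / 2) := Real.rpow_le_rpow_of_exponent_le (by norm_num) hle
    _ = 8 * (2 : ℝ) ^ ((n : ℝ) / 2) := by
        rw [Real.rpow_add (by norm_num)]
        norm_num

end Literature.Computability.QuantumComplexity

end
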